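import Mathlib
import HarnessLib
import Summits.FinalStateConjecture.FinalStateConjecture.Theorems.LogTimeThreeAnnuliDyadicCaptureCaptureUpgradeB

/-!
# Route LogTimeThreeAnnuli · crux `DyadicCapture` · line `registered` — capture upgrade, part C

Growing slabs and the chart-level assembly of the `Cᵏ` upgrade WITHOUT summability (lead c3, skeleton
v6 of the line; parts A–B: rigidity modulus, capture, uniform slab jets, fixed slabs).

* `captureC_far_pointwise` — for window members `p`, `p∞ = (M', a')` and a far point `y` of a slab
  (`|ỹ| ≥ s`, `s² ≥ R₀² + (|χ|/m₀)²`): `‖Dᵐ(Ψ^*g − g_{p∞})(y)‖ ≤ ‖Dᵐ(Ψ^*g − g_p)(y)‖ + 2C/R₀` with the uniform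
  far-field constants `(C, R₀)` of the window (`freezing_decay_uniform`; adapted from
  `freezing_far_pointwise`).
* `captureC_tendsto_growing` — fixed-slab convergence + windowed closeness on the growing slab ⟹
  `δᵏ_{R(τ)}(τ; M', a') → 0` (near points lie in a fixed slab, far points by `captureC_far_pointwise`).
* `captureC_main` — **capture upgrade for one chart**: a smooth chart on the reference boosted Kerr
  exterior of `(M', a')`, `0 < M'`, which is `C⁰`-normalised on fixed slabs and windowed-close (fixed and
  growing slab, same member) converges to the reference member in every `Cᵏ` on fixed and growing slabs,
  and `(M', a')` lies in the window. `captureC_main_sig` is its registered closed form.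

Sources: Kerr–Schild 1965 §2–§3; DHRT arXiv:2104.08222 §1 (the deviation norms).
-/

-- the `Summit.FinalStateConjecture.FinalStateConjecture.…` namespace repeats the summit = sub-problem
-- segment (D-0017 layout, CONVENTIONS §2); the duplicate is deliberate.
set_option linter.dupNamespace false

noncomputable section

namespace Summit.FinalStateConjecture.FinalStateConjecture.Theorems

open Literature.Geometry.Lorentzian
open scoped Topology Manifold ENNReal ContDiff
open Filter Set

section Chart

variable {𝓢 : Spacetime.{0} 4} (Λ : lorentzGroup) (c : E4) (M' a' : ℝ)
  (Ψ : (boostedKerrExterior Λ c M' a') → 𝓢.carrier)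

/-! ### Growing slabs -/

-- long statements; the structure-update backgrounds and the operator-norm instance paths unify slowly
set_option synthInstance.maxHeartbeats 200000 in
set_option maxHeartbeats 1600000 in
/-- **Far points, pointwise**: for window members `p` and `p∞ = (M', a')` (both in the window), a point
`y` of any slab with `|ỹ| ≥ s`, `s² ≥ R₀² + (|χ|/m₀)²`, and `m ≤ k`:
`‖Dᵐ(Ψ^*g − g_{p∞})(y)‖ ≤ ‖Dᵐ(Ψ^*g − g_p)(y)‖ + 2C/R₀`, where `(C, R₀)` are the far-field constants of the
window (`g_p − g_{p∞} = (g_p − η) − (g_{p∞} − η)`; adapted from `freezing_far_pointwise`).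
[cite: KerrSchild1965, §3] -/
theorem captureC_far_pointwise (hΨ : ContMDiff 𝓘(ℝ, E4) (𝓡 4) ∞ Ψ) {m₀ χ : ℝ} (hm₀ : 0 < m₀)
    {k m : ℕ} (hm : m ≤ k) {p : ℝ × ℝ}
    (hpW : p ∈ {q : ℝ × ℝ | m₀ ≤ q.1 ∧ q.1 ≤ m₀⁻¹ ∧ |q.2| ≤ χ * q.1})
    (hpinfW : ((M', a') : ℝ × ℝ) ∈ {q : ℝ × ℝ | m₀ ≤ q.1 ∧ q.1 ≤ m₀⁻¹ ∧ |q.2| ≤ χ * q.1})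
    {C R₀ s : ℝ} (hR₀ : 0 < R₀)
    (hdecay : ∀ m ≤ k, ∀ (M a : ℝ), m₀ ≤ M → M ≤ m₀⁻¹ → |a| ≤ χ * M → ∀ x : E4,
      R₀ ≤ Kerr.radius a (poincareInv Λ c x) →
      ‖iteratedFDeriv ℝ m (fun y ↦ boostedKerrBilin Λ c M a y - Minkowski.bilin) x‖ ≤
        C / Kerr.radius a (poincareInv Λ c x))
    (hs : R₀ ^ 2 + (|χ| * m₀⁻¹) ^ 2 ≤ s ^ 2) (hs0 : 0 ≤ s)
    {R' τ : ℝ} {y : E4} (hy : y ∈ Subtype.val '' (({boostedKerrBackground Λ c M' a' with bilin := boostedKerrBilin Λ c M' a'} : ModelBackground)).truncTimeSlab R' τ)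
    (hfar : s ≤ E4.spatialNorm (poincareInv Λ c y)) :
    ‖iteratedFDeriv ℝ m (𝓢.deviationExtend ({boostedKerrBackground Λ c M' a' with bilin := boostedKerrBilin Λ c M' a'} : ModelBackground) Ψ) y‖ₑ ≤
      ‖iteratedFDeriv ℝ m (𝓢.deviationExtend ({boostedKerrBackground Λ c M' a' with bilin := boostedKerrBilin Λ c (Prod.fst p) (Prod.snd p)} : ModelBackground) Ψ) y‖ₑ + 2 * ENNReal.ofReal (C / R₀) := by
  -- adapted from `freezing_far_pointwise` (FreezingD)
  have hyU : y ∈ (boostedKerrExterior Λ c M' a' : Set E4) :=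
    ((freezing_mem_slab_iff Λ c M' a' _ R' τ y).1 hy).1
  -- every window member has radius `≥ R₀` at `y`
  have hradW : ∀ q ∈ {q : ℝ × ℝ | m₀ ≤ q.1 ∧ q.1 ≤ m₀⁻¹ ∧ |q.2| ≤ χ * q.1},
      R₀ ≤ Kerr.radius q.2 (poincareInv Λ c y) := by
    intro q hq
    refine freezing_le_radius_of_sq_le hR₀.le ?_
    have ha : |q.2| ≤ |χ| * m₀⁻¹ := freezing_abs_le_of_window hm₀ hq
    have ha2 : q.2 ^ 2 ≤ (|χ| * m₀⁻¹) ^ 2 := by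
      rw [← sq_abs q.2]; exact pow_le_pow_left₀ (abs_nonneg _) ha 2
    have hs2 : s ^ 2 ≤ E4.spatialNorm (poincareInv Λ c y) ^ 2 := pow_le_pow_left₀ hs0 hfar 2
    linarith
  have hrad : 0 < Kerr.radius p.2 (poincareInv Λ c y) := hR₀.trans_le (hradW p hpW)
  have hradinf : 0 < Kerr.radius a' (poincareInv Λ c y) := hR₀.trans_le (hradW (M', a') hpinfW)
  -- decay bounds for the two members at `y`, in `ℝ≥0∞`
  have hdec : ∀ q ∈ {q : ℝ × ℝ | m₀ ≤ q.1 ∧ q.1 ≤ m₀⁻¹ ∧ |q.2| ≤ χ * q.1},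
      ‖iteratedFDeriv ℝ m (fun z ↦ boostedKerrBilin Λ c q.1 q.2 z - Minkowski.bilin) y‖ₑ ≤
        ENNReal.ofReal (C / R₀) := by
    intro q hq
    have hr := hradW q hq
    have h := hdecay m hm q.1 q.2 hq.1 hq.2.1 hq.2.2 y hr
    rw [← ofReal_norm]
    refine ENNReal.ofReal_le_ofReal (h.trans ?_)
    have hC : 0 ≤ C := by
      have := (norm_nonneg _).trans h
      exact (div_nonneg_iff.1 this).elim (fun h' ↦ h'.1) fun h' ↦ by
        exfalso; linarith [hR₀.trans_le hr, h'.2]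
    exact div_le_div_of_nonneg_left hC hR₀ hr
  -- smooth triangle inequality and the identity `g_p − g_q = (g_p − η) − (g_q − η)`
  have h1 := freezing_enorm_iteratedFDeriv_dev_le (𝓢 := 𝓢) (boostedKerrBackground Λ c M' a') Ψ
    (boostedKerrBilin Λ c p.1 p.2) (boostedKerrBilin Λ c M' a') hΨ hyU
    (freezing_contDiffAt_boosted Λ c p hrad) (freezing_contDiffAt_boosted Λ c (M', a') hradinf) m
  have hcp : ContDiffAt ℝ m (fun z ↦ boostedKerrBilin Λ c p.1 p.2 z - Minkowski.bilin) y :=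
    ((freezing_contDiffAt_boosted Λ c p hrad).of_le (mod_cast le_top)).sub contDiffAt_const
  have hcq : ContDiffAt ℝ m (fun z ↦ boostedKerrBilin Λ c M' a' z - Minkowski.bilin) y :=
    ((freezing_contDiffAt_boosted Λ c (M', a') hradinf).of_le (mod_cast le_top)).sub contDiffAt_const
  have h2 : iteratedFDeriv ℝ m (fun z ↦ boostedKerrBilin Λ c p.1 p.2 z - boostedKerrBilin Λ c M' a' z) y =
      iteratedFDeriv ℝ m (fun z ↦ boostedKerrBilin Λ c p.1 p.2 z - Minkowski.bilin) y -
        iteratedFDeriv ℝ m (fun z ↦ boostedKerrBilin Λ c M' a' z - Minkowski.bilin) y := by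
    rw [← iteratedFDeriv_sub_apply hcp hcq]
    congr 1
    funext z
    simp only [Pi.sub_apply]
    abel
  rw [h2] at h1
  calc ‖iteratedFDeriv ℝ m (𝓢.deviationExtend ({boostedKerrBackground Λ c M' a' with bilin := boostedKerrBilin Λ c M' a'} : ModelBackground) Ψ) y‖ₑ ≤ _ := h1
    _ ≤ ‖iteratedFDeriv ℝ m (𝓢.deviationExtend ({boostedKerrBackground Λ c M' a' with bilin := boostedKerrBilin Λ c (Prod.fst p) (Prod.snd p)} : ModelBackground) Ψ) y‖ₑ +
        (ENNReal.ofReal (C / R₀) + ENNReal.ofReal (C / R₀)) :=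
          add_le_add le_rfl (enorm_sub_le.trans (add_le_add (hdec p hpW) (hdec (M', a') hpinfW)))
    _ = ‖iteratedFDeriv ℝ m (𝓢.deviationExtend ({boostedKerrBackground Λ c M' a' with bilin := boostedKerrBilin Λ c (Prod.fst p) (Prod.snd p)} : ModelBackground) Ψ) y‖ₑ + 2 * ENNReal.ofReal (C / R₀) := by rw [two_mul]

-- long statements; the structure-update backgrounds and the operator-norm instance paths unify slowly
set_option synthInstance.maxHeartbeats 200000 in
set_option maxHeartbeats 3200000 in
/-- **`Cᵏ` convergence on the growing slabs.** If the reference member `(M', a')` lies in the window,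
`δᵏ_ρ(τ; M', a') → 0` for every fixed `ρ`, and for every `ε > 0` eventually some window member is
`ε`-close in `Cᵏ` to `Ψ^* g` on the growing slab `{t* = τ, r ≤ R(τ)}`, then `δᵏ_{R(τ)}(τ; M', a') → 0`:
near points (`|ỹ| < s`) lie in the fixed slab of radius `s`, far points are handled by
`captureC_far_pointwise` with the uniform far-field constants of the window. [cite: KerrSchild1965, §3] -/
theorem captureC_tendsto_growing (hΨ : ContMDiff 𝓘(ℝ, E4) (𝓡 4) ∞ Ψ) {m₀ χ : ℝ} (hm₀ : 0 < m₀)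
    (hpinfW : ((M', a') : ℝ × ℝ) ∈ {q : ℝ × ℝ | m₀ ≤ q.1 ∧ q.1 ≤ m₀⁻¹ ∧ |q.2| ≤ χ * q.1})
    (R : ℝ → ℝ) (k : ℕ)
    (hfix : ∀ ρ : ℝ, Tendsto (fun τ : ℝ ↦ 𝓢.truncDeviationCk ({boostedKerrBackground Λ c M' a' with bilin := boostedKerrBilin Λ c M' a'} : ModelBackground) Ψ k ρ τ) atTop (𝓝 0))
    (hWg : ∀ ε : ℝ≥0∞, 0 < ε → ∀ᶠ τ : ℝ in atTop, ∃ p ∈ {q : ℝ × ℝ | m₀ ≤ q.1 ∧ q.1 ≤ m₀⁻¹ ∧ |q.2| ≤ χ * q.1},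
      𝓢.truncDeviationCk ({boostedKerrBackground Λ c M' a' with bilin := boostedKerrBilin Λ c (Prod.fst p) (Prod.snd p)} : ModelBackground) Ψ k (R τ) τ ≤ ε) :
    Tendsto (fun τ : ℝ ↦ 𝓢.truncDeviationCk ({boostedKerrBackground Λ c M' a' with bilin := boostedKerrBilin Λ c M' a'} : ModelBackground) Ψ k (R τ) τ) atTop (𝓝 0) := by
  -- adapted from the growing-slab part of `freezing_main` (Freezing)
  rw [ENNReal.tendsto_nhds_zero]
  intro ε hε
  rcases eq_top_or_lt_top ε with hεtop | hεtop
  · exact Eventually.of_forall fun τ ↦ hεtop ▸ le_top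
  have hη : 0 < ε.toReal := ENNReal.toReal_pos hε.ne' hεtop.ne
  set η : ℝ := ε.toReal with hηdef
  -- far-field constants for orders `≤ k`, and the far radius
  obtain ⟨C, Rd, hRd, hdecay⟩ := freezing_decay_uniform Λ c χ hm₀ k
  set Cp : ℝ := max C 0 with hCp
  have hCp0 : 0 ≤ Cp := le_max_right _ _
  set Rbig : ℝ := max Rd (6 * Cp / η + 1) with hRbig
  have hRbig0 : 0 < Rbig := lt_max_of_lt_left hRd
  have hdecay' : ∀ m ≤ k, ∀ (M a : ℝ), m₀ ≤ M → M ≤ m₀⁻¹ → |a| ≤ χ * M → ∀ x : E4,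
      Rbig ≤ Kerr.radius a (poincareInv Λ c x) →
      ‖iteratedFDeriv ℝ m (fun y ↦ boostedKerrBilin Λ c M a y - Minkowski.bilin) x‖ ≤
        Cp / Kerr.radius a (poincareInv Λ c x) := by
    intro m hm M a hM1 hM2 ha x hx
    have hr : 0 < Kerr.radius a (poincareInv Λ c x) := hRbig0.trans_le hx
    exact (hdecay m hm M a hM1 hM2 ha x ((le_max_left _ _).trans hx)).trans
      (div_le_div_of_nonneg_right (le_max_left _ _) hr.le)
  have hCR : Cp / Rbig ≤ η / 6 := by
    have h6 : 6 * Cp / η + 1 ≤ Rbig := le_max_right _ _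
    have hη0 : η ≠ 0 := hη.ne'
    rw [div_le_iff₀ hRbig0]
    have h7 : η / 6 * (6 * Cp / η + 1) ≤ η / 6 * Rbig := mul_le_mul_of_nonneg_left h6 (by positivity)
    have h8 : η / 6 * (6 * Cp / η + 1) = Cp + η / 6 := by field_simp
    nlinarith [h7, h8, hη]
  set s : ℝ := Rbig + |χ| * m₀⁻¹ with hs
  have hs0 : 0 ≤ s := by positivity
  have hs2 : Rbig ^ 2 + (|χ| * m₀⁻¹) ^ 2 ≤ s ^ 2 := by
    rw [hs]; nlinarith [hRbig0, abs_nonneg χ, inv_pos.2 hm₀, mul_nonneg (abs_nonneg χ) (inv_pos.2 hm₀).le]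
  -- eventually: the fixed slab of radius `s` is `η/2`-good and a window member is `η/6`-good on the growing slab
  have hev := (ENNReal.tendsto_nhds_zero.1 (hfix s) (ENNReal.ofReal (η / 2)) (ENNReal.ofReal_pos.2 (by linarith))).and
    (hWg (ENNReal.ofReal (η / 6)) (ENNReal.ofReal_pos.2 (by linarith)))
  filter_upwards [hev] with τ hτ
  obtain ⟨hF, p, hpW, hP⟩ := hτ
  have hpt : ∀ m ≤ k, ∀ y ∈ Subtype.val '' (({boostedKerrBackground Λ c M' a' with bilin := boostedKerrBilin Λ c M' a'} : ModelBackground)).truncTimeSlab (R τ) τ,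
      ‖iteratedFDeriv ℝ m (𝓢.deviationExtend ({boostedKerrBackground Λ c M' a' with bilin := boostedKerrBilin Λ c M' a'} : ModelBackground) Ψ) y‖ₑ ≤
        ENNReal.ofReal (η / 2) + ENNReal.ofReal (η / 3) := by
    intro m hm y hy
    rcases lt_or_ge (E4.spatialNorm (poincareInv Λ c y)) s with hnear | hfar
    · -- near: `r_{a'} ≤ |ỹ| < s`
      have hy' : y ∈ Subtype.val '' (({boostedKerrBackground Λ c M' a' with bilin := boostedKerrBilin Λ c M' a'} : ModelBackground)).truncTimeSlab s τ := by
        rw [freezing_mem_slab_iff] at hy ⊢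
        exact ⟨hy.1, hy.2.1, (Kerr.radius_le_spatialNorm a' _).trans hnear.le⟩
      calc ‖iteratedFDeriv ℝ m (𝓢.deviationExtend ({boostedKerrBackground Λ c M' a' with bilin := boostedKerrBilin Λ c M' a'} : ModelBackground) Ψ) y‖ₑ
          ≤ 𝓢.truncDeviationCk ({boostedKerrBackground Λ c M' a' with bilin := boostedKerrBilin Λ c M' a'} : ModelBackground) Ψ k s τ :=
            freezing_enorm_iteratedFDeriv_le_truncDeviationCk (𝓢 := 𝓢) (boostedKerrBackground Λ c M' a') Ψ
              (boostedKerrBilin Λ c M' a') hm hy'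
        _ ≤ ENNReal.ofReal (η / 2) := hF
        _ ≤ ENNReal.ofReal (η / 2) + ENNReal.ofReal (η / 3) := le_self_add
    · -- far
      have hyp : y ∈ Subtype.val '' (({boostedKerrBackground Λ c M' a' with bilin := boostedKerrBilin Λ c (Prod.fst p) (Prod.snd p)} : ModelBackground)).truncTimeSlab (R τ) τ := by
        rw [freezing_mem_slab_iff] at hy ⊢; exact hy
      calc ‖iteratedFDeriv ℝ m (𝓢.deviationExtend ({boostedKerrBackground Λ c M' a' with bilin := boostedKerrBilin Λ c M' a'} : ModelBackground) Ψ) y‖ₑ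
          ≤ ‖iteratedFDeriv ℝ m (𝓢.deviationExtend ({boostedKerrBackground Λ c M' a' with bilin := boostedKerrBilin Λ c (Prod.fst p) (Prod.snd p)} : ModelBackground) Ψ) y‖ₑ + 2 * ENNReal.ofReal (Cp / Rbig) :=
            captureC_far_pointwise Λ c M' a' Ψ hΨ hm₀ hm hpW hpinfW hRbig0 hdecay' hs2 hs0 hy hfar
        _ ≤ ENNReal.ofReal (η / 6) + 2 * ENNReal.ofReal (η / 6) := by
            refine add_le_add ?_ ?_
            · exact (freezing_enorm_iteratedFDeriv_le_truncDeviationCk (𝓢 := 𝓢) (boostedKerrBackground Λ c M' a')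
                Ψ (boostedKerrBilin Λ c p.1 p.2) hm hyp).trans hP
            · exact mul_le_mul_right (ENNReal.ofReal_le_ofReal hCR) 2
        _ = ENNReal.ofReal (η / 2) := by
            rw [← ENNReal.ofReal_ofNat 2, ← ENNReal.ofReal_mul (by norm_num),
              ← ENNReal.ofReal_add (by linarith) (by positivity)]
            congr 1
            ring
        _ ≤ ENNReal.ofReal (η / 2) + ENNReal.ofReal (η / 3) := le_self_add
  calc 𝓢.truncDeviationCk ({boostedKerrBackground Λ c M' a' with bilin := boostedKerrBilin Λ c M' a'} : ModelBackground) Ψ k (R τ) τ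
      ≤ ENNReal.ofReal (η / 2) + ENNReal.ofReal (η / 3) := by
        show supCkENorm _ k _ ≤ _
        exact iSup₂_le fun m hm ↦ iSup₂_le fun y hy ↦ hpt m hm y hy
    _ = ENNReal.ofReal (η / 2 + η / 3) := (ENNReal.ofReal_add (by linarith) (by linarith)).symm
    _ ≤ ENNReal.ofReal η := ENNReal.ofReal_le_ofReal (by linarith)
    _ = ε := ENNReal.ofReal_toReal hεtop.ne

/-! ### The chart-level capture upgrade -/

-- long statements; the structure-update backgrounds and the operator-norm instance paths unify slowly
set_option synthInstance.maxHeartbeats 200000 in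
set_option maxHeartbeats 3200000 in
/-- **Capture upgrade for one chart.** A smooth chart on the reference boosted Kerr exterior of
`(M', a')`, `0 < M'`, which is `C⁰`-normalised (its `C⁰` distance to the REFERENCE member tends to `0`
on every fixed slab) and windowed-close (for every `k, ρ, ε`, eventually some member of the window
`m₀ ≤ M ≤ 1/m₀`, `|a| ≤ χM` is `ε`-close in `Cᵏ` on the fixed slab of radius `ρ` and on the growing slab
of radius `R(τ)`) converges to the reference member in every `Cᵏ`, on every fixed slab and on the
growing slabs, and `(M', a')` lies in the window. No summability is used. [cite: KerrSchild1965, §2] -/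
theorem captureC_main (hΨ : ContMDiff 𝓘(ℝ, E4) (𝓡 4) ∞ Ψ) (hM' : 0 < M') (R : ℝ → ℝ) {m₀ χ : ℝ}
    (hm₀ : 0 < m₀)
    (hW : ∀ (k : ℕ) (ρ : ℝ) (ε : ℝ≥0∞), 0 < ε → ∀ᶠ τ : ℝ in atTop, ∃ M a : ℝ,
      m₀ ≤ M ∧ M ≤ m₀⁻¹ ∧ |a| ≤ χ * M ∧
      𝓢.truncDeviationCk ({boostedKerrBackground Λ c M' a' with bilin := boostedKerrBilin Λ c M a} : ModelBackground) Ψ k ρ τ ≤ ε ∧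
      𝓢.truncDeviationCk ({boostedKerrBackground Λ c M' a' with bilin := boostedKerrBilin Λ c M a} : ModelBackground) Ψ k (R τ) τ ≤ ε)
    (hN : ∀ ρ : ℝ, Tendsto (fun τ : ℝ ↦ 𝓢.truncDeviationCk ({boostedKerrBackground Λ c M' a' with bilin := boostedKerrBilin Λ c M' a'} : ModelBackground) Ψ 0 ρ τ) atTop (𝓝 0)) :
    (m₀ ≤ M' ∧ M' ≤ m₀⁻¹ ∧ |a'| ≤ χ * M') ∧
      (∀ (k : ℕ) (ρ : ℝ), Tendsto (fun τ : ℝ ↦ 𝓢.truncDeviationCk ({boostedKerrBackground Λ c M' a' with bilin := boostedKerrBilin Λ c M' a'} : ModelBackground) Ψ k ρ τ)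
        atTop (𝓝 0)) ∧
      (∀ k : ℕ, Tendsto (fun τ : ℝ ↦ 𝓢.truncDeviationCk ({boostedKerrBackground Λ c M' a' with bilin := boostedKerrBilin Λ c M' a'} : ModelBackground) Ψ k (R τ) τ)
        atTop (𝓝 0)) := by
  -- anchor and the basic radius
  obtain ⟨y₀, h0, h1, h2, h3, hy₀⟩ := freezing_exists_anchor M' a'
  set ρ₀ : ℝ := max (Kerr.radius a' y₀) (|χ| * m₀⁻¹ + 1) with hρ₀
  -- the fixed part of the windowed closeness
  have hWf : ∀ (k : ℕ) (ρ : ℝ) (ε : ℝ≥0∞), 0 < ε → ∀ᶠ τ : ℝ in atTop,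
      ∃ p ∈ {q : ℝ × ℝ | m₀ ≤ q.1 ∧ q.1 ≤ m₀⁻¹ ∧ |q.2| ≤ χ * q.1}, 𝓢.truncDeviationCk ({boostedKerrBackground Λ c M' a' with bilin := boostedKerrBilin Λ c (Prod.fst p) (Prod.snd p)} : ModelBackground) Ψ k ρ τ ≤ ε := by
    intro k ρ ε hε
    filter_upwards [hW k ρ ε hε] with τ hτ
    obtain ⟨M, a, hM1, hM2, ha, hfix, -⟩ := hτ
    exact ⟨(M, a), ⟨hM1, hM2, ha⟩, hfix⟩
  -- the growing part of the windowed closeness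
  have hWg : ∀ (k : ℕ) (ε : ℝ≥0∞), 0 < ε → ∀ᶠ τ : ℝ in atTop,
      ∃ p ∈ {q : ℝ × ℝ | m₀ ≤ q.1 ∧ q.1 ≤ m₀⁻¹ ∧ |q.2| ≤ χ * q.1},
        𝓢.truncDeviationCk ({boostedKerrBackground Λ c M' a' with bilin := boostedKerrBilin Λ c (Prod.fst p) (Prod.snd p)} : ModelBackground) Ψ k (R τ) τ ≤ ε := by
    intro k ε hε
    filter_upwards [hW k 0 ε hε] with τ hτ
    obtain ⟨M, a, hM1, hM2, ha, -, hgrow⟩ := hτ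
    exact ⟨(M, a), ⟨hM1, hM2, ha⟩, hgrow⟩
  -- the reference member lies in the window
  have hpinfW : ((M', a') : ℝ × ℝ) ∈ {q : ℝ × ℝ | m₀ ≤ q.1 ∧ q.1 ≤ m₀⁻¹ ∧ |q.2| ≤ χ * q.1} :=
    captureA_mem_window Λ c M' a' Ψ hM' h0 h1 h2 h3 hy₀ hm₀ (hWf 0 (Kerr.radius a' y₀))
      (hN (Kerr.radius a' y₀))
  -- fixed slabs
  have hfixed : ∀ (k : ℕ) (ρ : ℝ), Tendsto (fun τ : ℝ ↦ 𝓢.truncDeviationCk ({boostedKerrBackground Λ c M' a' with bilin := boostedKerrBilin Λ c M' a'} : ModelBackground) Ψ k ρ τ)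
      atTop (𝓝 0) := by
    intro k ρ
    set ρ' : ℝ := max ρ ρ₀ with hρ'
    have h := captureB_tendsto_fixed Λ c M' a' Ψ hΨ hM' h0 h1 h2 h3 hy₀ hm₀ k
      ((le_max_left _ _).trans (le_max_right ρ ρ₀)) ((le_max_right _ _).trans (le_max_right ρ ρ₀))
      (hWf k ρ') (hN (Kerr.radius a' y₀))
    exact tendsto_of_tendsto_of_tendsto_of_le_of_le tendsto_const_nhds h (fun _ ↦ zero_le)
      fun τ ↦ 𝓢.truncDeviationCk_mono ({boostedKerrBackground Λ c M' a' with bilin := boostedKerrBilin Λ c M' a'} : ModelBackground) Ψ k (le_max_left ρ ρ₀) τ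
  refine ⟨hpinfW, hfixed, fun k ↦ ?_⟩
  exact captureC_tendsto_growing Λ c M' a' Ψ hΨ hm₀ hpinfW R k (hfixed k) (hWg k)

end Chart

-- the structure-update backgrounds unfold slowly
set_option synthInstance.maxHeartbeats 200000 in
set_option maxHeartbeats 1600000 in
/-- **Part C, registered form** (`captureC_main_sig`): the capture upgrade for one chart, closed statement
(see `captureC_main`). [cite: KerrSchild1965, §2] -/
theorem captureC_main_sig : ∀ (𝓢 : Spacetime.{0} 4) (Λ : lorentzGroup) (c : E4) (M' a' : ℝ) (Ψ : (boostedKerrExterior Λ c M' a') → 𝓢.carrier), ContMDiff 𝓘(ℝ, E4) (𝓡 4) ∞ Ψ → 0 < M' → ∀ (R : ℝ → ℝ) (m₀ χ : ℝ), 0 < m₀ → (∀ (k : ℕ) (ρ : ℝ) (ε : ENNReal), 0 < ε → ∀ᶠ τ : ℝ in Filter.atTop, ∃ M a : ℝ, m₀ ≤ M ∧ M ≤ m₀⁻¹ ∧ |a| ≤ χ * M ∧ 𝓢.truncDeviationCk ({boostedKerrBackground Λ c M' a' with bilin := boostedKerrBilin Λ c M a} : ModelBackground) Ψ k ρ τ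 ≤ ε ∧ 𝓢.truncDeviationCk ({boostedKerrBackground Λ c M' a' with bilin := boostedKerrBilin Λ c M a} : ModelBackground) Ψ k (R τ) τ ≤ ε) → (∀ ρ : ℝ, Filter.Tendsto (fun τ : ℝ => 𝓢.truncDeviationCk ({boostedKerrBackground Λ c M' a' with bilin := boostedKerrBilin Λ c M' a'} : ModelBackground) Ψ 0 ρ τ) Filter.atTop (nhds 0)) → (m₀ ≤ M' ∧ M' ≤ m₀⁻¹ ∧ |a'| ≤ χ * M') ∧ (∀ (k : ℕ) (ρ : ℝ), Filter.Tendsto (fun τ : ℝ => 𝓢.truncDeviationCk ({boostedKerrBackground Λ c M' a' with bilin := boostedKerrBilin Λ c M' a'} : ModelBackground) Ψ k ρ τ) Filter.atTop (nhds 0)) ∧ (∀ k : ℕ, Filter.Tendsto (fun τ : ℝ => 𝓢.truncDeviationCk ({boostedKerrBackground Λ c M' a' with bilin := boostedKerrBilin Λ c M' a'} : ModelBackground) Ψ k (R τ) τ) Filter.atTop (nhds 0)) :=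
  fun _ Λ c M' a' Ψ hΨ hM' R _ _ hm₀ hW hN ↦ captureC_main Λ c M' a' Ψ hΨ hM' R hm₀ hW hN

end Summit.FinalStateConjecture.FinalStateConjecture.Theorems

end
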